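import Summits.HodgeConjecture.HodgeConjecture.Theorems.Ring2AbelianAllAndreLerayIdempotent
import Summits.HodgeConjecture.HodgeConjecture.Theorems.Ring2AbelianAllLefschetzPencilsQuasiInverse
import HarnessLib

/-!
# Ring 2 · sub-cell AbelianAll (ALL ABELIAN VARIETIES), André axis, part XXVII-b — SUPPLIERS OF THE ALGEBRAIC LERAY IDEMPOTENT:
# the weight package (wt), (wt₃), (top) of an endomorphism IS one idempotent; a clause of the fibre-class Lefschetz node (β′_f) gives one

HONEST FRAMING (page 1, verbatim): **research route, not a corollary; conditional on HC_CM plus one named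
minimal statement.** Cell line: research route conditional on HC_CM; not a corollary; Q11.4-sentence-2
already refuted in dim ≥ 3. Nothing in this file proves a case of the Hodge conjecture for an abelian variety; `HC_CM` does not occur in this
file; item `Theses.RankFourFaces.CMToAbelian` (stmt-16267) OPEN and not closed here. Seat `pub-hodge-ring2-ab-andre-2`, gen 19; brief (ii).

## What is proved (theorems only; no definition, no named fact, no sorry; `HC_CM` absent)

Notation of part XXVII-a: `f : 𝒳 ⟶ S` a compact pencil of abelian `d`-folds, `t` a point, `r = j_t^*`; an ALGEBRAIC LERAY IDEMPOTENT at
`t` in degree `k` is an endomorphism `e` of `Hᵏ(𝒳(ℂ); ℂ)` with (Π1) `IsAlgebraicCorrespondence (d+1) (d+1) 𝒳 𝒳 e`, (Π2) `e` preserves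
rational classes, (π) `r ∘ e = r`, (κ) `e|_{ker r} = 0`.

* **`exists_lerayIdempotent_of_weights` — THE WEIGHT PACKAGE IS ONE IDEMPOTENT.** Granted (wt), (wt₃), (top) in degree `2(p+1) ≤ 2(d+1)`
  for an endomorphism `ν` of `𝒳` and `N ≥ 2` (print theorems for `ν = θ_N` on an abelian scheme; displayed hypotheses of parts XXIV–XXVI),
  the Lagrange polynomial `e = (ν^* − N^{2p+1})(ν^* − N^{2p}) / ((N^{2p+2} − N^{2p+1})(N^{2p+2} − N^{2p}))` has (Π1) (a polynomial in the
  graph correspondence `ν^*`, part XXII-e), (Π2) (rational coefficients), (π) ((wt) alone), (κ) ((wt₃), (top)), and `e y = y ⟺ ν^* y =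
  N^{2p+2} y`: the top-weight classes of parts XXIV–XXVI are exactly the `e`-fixed classes. No local quasi-finiteness of `ν` is used.
* **`exists_lerayIdempotent_of_fibreClassLefschetz_clause`**, **`exists_lerayIdempotent_of_fibreClassLefschetzOn`** — a clause `p ≤ d` of
  (β′_f) (part VIII's `FibreClassLefschetzOn`: an algebraic `T : H^{2p+2}(𝒳) → H^{2p}(𝒳)` with `j_s^* T L_t = j_s^*` for all `s`) gives
  `e = T ∘ L_t` with (Π1), (π) at EVERY point `s`, and (κ). (Π2) is NOT claimed (the tree's algebraic correspondences have complex
  coefficients; normalising a solution of the `ℚ`-linear constraints (π), (κ) to rational coefficients is routine in print and not typed).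

## Honest status

No node is born; nothing is minimal; nothing here is fact-free progress on `HC_AV`. The two suppliers are the two André-axis hypothesis
families of record: (θ∀) `PencilTheta[]` (through `CMWeights[]`, parts XXV–XXVI) and the Lefschetz-type node (β′). The node-level edges
`CMWeights[] ⟹ CMLerayIdempotent[] ⟸ …` and the rows are part XXVII-c (`Ring2AbelianAllAndreLerayIdempotentNodes`).

References: Milne2020HodgeClassesAV (proof of Prop. 1, p. 7); DeningerMurre1991 (Thm. 3.1); Kleiman1968AlgebraicCycles (p. 374, §1.3);
Abdulali1994FamiliesAV (Conj. 5.3, p. 1130); VoisinHodgeII2003 ((10.7), Prop. 9.20–9.21); Andre1996Motifs (§2.1, Remarque 2); MumfordGIT (Thm. 6.14).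
-/

noncomputable section

set_option linter.dupNamespace false

namespace Summit.HodgeConjecture.HodgeConjecture.Ring2.AbelianAll

open CategoryTheory AlgebraicGeometry
open Literature.AlgebraicGeometry Literature.AlgebraicGeometry.Motives
open Literature.AlgebraicGeometry.HodgeTheory

/-! ## §5 Suppliers: the Leray weights of an endomorphism; a clause of the fibre-class Lefschetz node (β′_f) -/

section Suppliers

variable {𝒳 S : SchemeOver ℂ} {d : ℕ} {f : 𝒳 ⟶ S}

/-- **THE WEIGHT PACKAGE IS ONE IDEMPOTENT.** Granted (wt), (wt₃), (top) in degree `2(p+1) ≤ 2(d+1)` for an endomorphism `ν` of the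
total space and `N ≥ 2` (print theorems for `ν = θ_N` on an abelian scheme), the Lagrange polynomial
`e = (ν^* − N^{2p+1})(ν^* − N^{2p}) / ((N^{2p+2} − N^{2p+1})(N^{2p+2} − N^{2p}))` is an algebraic Leray idempotent at `t`: (Π1) an
algebraic correspondence (a polynomial in the graph correspondence `ν^*`, part XXII-e), (Π2) preserving rational classes (rational
coefficients), (π) `j_t^* ∘ e = j_t^*` ((wt) alone), (κ) `e|_{ker j_t^*} = 0` ((wt₃), (top)); and **`e y = y ⟺ ν^* y = N^{2p+2} y`** — the
top-weight classes of parts XXIV–XXVI are exactly the `e`-fixed classes. No local quasi-finiteness of `ν` is needed.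
[cite: Milne2020HodgeClassesAV, proof of Prop. 1 (p. 7)] [cite: DeningerMurre1991, Thm. 3.1] [cite: Kleiman1968AlgebraicCycles, p. 374] -/
theorem exists_lerayIdempotent_of_weights (hf : IsCompactAbelianPencil f d) (t : ComplexPoints S) (ν : 𝒳 ⟶ 𝒳) {N : ℕ}
    (hN : 2 ≤ N) {p : ℕ} (hp : p ≤ d)
    (hwt : ∀ w : complexBetti 𝒳 (2 * (p + 1)), complexBetti.map (fiberι f t) (2 * (p + 1)) (complexBetti.map ν (2 * (p + 1)) w) =
      ((N : ℂ) ^ (2 * (p + 1))) • complexBetti.map (fiberι f t) (2 * (p + 1)) w)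
    (hwt₃ : ∀ w : complexBetti 𝒳 (2 * (p + 1)), ∃ w₀ w₁ w₂ : complexBetti 𝒳 (2 * (p + 1)), w = w₀ + w₁ + w₂ ∧
      complexBetti.map ν (2 * (p + 1)) w₀ = ((N : ℂ) ^ (2 * (p + 1))) • w₀ ∧
      complexBetti.map ν (2 * (p + 1)) w₁ = ((N : ℂ) ^ (2 * p + 1)) • w₁ ∧
      complexBetti.map ν (2 * (p + 1)) w₂ = ((N : ℂ) ^ (2 * p)) • w₂)
    (htop : ∀ G : complexBetti 𝒳 (2 * (p + 1)), complexBetti.map ν (2 * (p + 1)) G = ((N : ℂ) ^ (2 * (p + 1))) • G →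
      complexBetti.map (fiberι f t) (2 * (p + 1)) G = 0 → G = 0) :
    ∃ e : complexBetti 𝒳 (2 * (p + 1)) →ₗ[ℂ] complexBetti 𝒳 (2 * (p + 1)),
      IsAlgebraicCorrespondence (d + 1) (d + 1) 𝒳 𝒳 e ∧ (∀ w, IsRationalClass w → IsRationalClass (e w)) ∧
      (∀ w, complexBetti.map (fiberι f t) (2 * (p + 1)) (e w) = complexBetti.map (fiberι f t) (2 * (p + 1)) w) ∧
      (∀ w, complexBetti.map (fiberι f t) (2 * (p + 1)) w = 0 → e w = 0) ∧
      (∀ y, e y = y ↔ complexBetti.map ν (2 * (p + 1)) y = ((N : ℂ) ^ (2 * (p + 1))) • y) := by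
  have h𝒳 := hf.isSmoothProjective_total
  set T : complexBetti 𝒳 (2 * (p + 1)) →ₗ[ℂ] complexBetti 𝒳 (2 * (p + 1)) := (complexBetti.map ν (2 * (p + 1))).hom with hT
  have hT' : ∀ w, T w = complexBetti.map ν (2 * (p + 1)) w := fun _ ↦ rfl
  set q₀ : ℂ := (N : ℂ) ^ (2 * (p + 1))
  set q₁ : ℂ := (N : ℂ) ^ (2 * p + 1)
  set q₂ : ℂ := (N : ℂ) ^ (2 * p)
  have hc : (q₀ - q₁) * (q₀ - q₂) ≠ 0 :=
    mul_ne_zero (natCast_pow_sub_pow_ne_zero hN (by omega)) (natCast_pow_sub_pow_ne_zero hN (by omega))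
  -- the Lagrange idempotent
  set e : complexBetti 𝒳 (2 * (p + 1)) →ₗ[ℂ] complexBetti 𝒳 (2 * (p + 1)) :=
    ((q₀ - q₁) * (q₀ - q₂))⁻¹ • (T ∘ₗ T - (q₁ + q₂) • T + (q₁ * q₂) • LinearMap.id) with he_def
  have he : ∀ w, e w = ((q₀ - q₁) * (q₀ - q₂))⁻¹ • (T (T w) - (q₁ + q₂) • T w + (q₁ * q₂) • w) := fun w ↦ by
    simp only [he_def, LinearMap.smul_apply, LinearMap.add_apply, LinearMap.sub_apply, LinearMap.comp_apply, LinearMap.id_apply]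
  -- `e w` is the top-weight component of `w`
  have hcomp : ∀ w w₀ w₁ w₂ : complexBetti 𝒳 (2 * (p + 1)), w = w₀ + w₁ + w₂ →
      complexBetti.map ν (2 * (p + 1)) w₀ = q₀ • w₀ → complexBetti.map ν (2 * (p + 1)) w₁ = q₁ • w₁ →
      complexBetti.map ν (2 * (p + 1)) w₂ = q₂ • w₂ → e w = w₀ := by
    intro w w₀ w₁ w₂ hsum h₀ h₁ h₂
    have hLag : T (T w) - (q₁ + q₂) • T w + (q₁ * q₂) • w = ((q₀ - q₁) * (q₀ - q₂)) • w₀ := by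
      simp only [hT', hsum, map_add, h₀, h₁, h₂, map_smul, smul_add, smul_smul]
      module
    rw [he, hLag, smul_smul, inv_mul_cancel₀ hc, one_smul]
  refine ⟨e, ?_, ?_, ?_, ?_, ?_⟩
  · -- (Π1): a polynomial in the graph correspondence `ν^*`
    have hTalg : IsAlgebraicCorrespondence (d + 1) (d + 1) 𝒳 𝒳 T := isAlgebraicCorrespondence_map h𝒳 h𝒳 ν (by omega)
    have hTT : IsAlgebraicCorrespondence (d + 1) (d + 1) 𝒳 𝒳 (T ∘ₗ T) :=
      IsAlgebraicCorrespondence.comp h𝒳 h𝒳 h𝒳 hTalg hTalg (by omega)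
    have hid : IsAlgebraicCorrespondence (d + 1) (d + 1) 𝒳 𝒳
        (LinearMap.id : complexBetti 𝒳 (2 * (p + 1)) →ₗ[ℂ] complexBetti 𝒳 (2 * (p + 1))) :=
      isAlgebraicCorrespondence_id h𝒳 (by omega)
    rw [he_def]
    exact IsAlgebraicCorrespondence.smul h𝒳 h𝒳
      (IsAlgebraicCorrespondence.add h𝒳 h𝒳
        (IsAlgebraicCorrespondence.sub h𝒳 h𝒳 hTT (IsAlgebraicCorrespondence.smul h𝒳 h𝒳 hTalg _))
        (IsAlgebraicCorrespondence.smul h𝒳 h𝒳 hid _)) _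
  · -- (Π2): rational coefficients, and `ν^*` preserves rational classes
    intro w hw
    have hTQ : ∀ w : complexBetti 𝒳 (2 * (p + 1)), IsRationalClass w → IsRationalClass (T w) :=
      fun w hw ↦ hw.map (AlgPoints.mapContinuous (L := ℂ) ν)
    set r₁ : ℚ := -((N : ℚ) ^ (2 * p + 1) + (N : ℚ) ^ (2 * p))
    set r₂ : ℚ := (N : ℚ) ^ (2 * p + 1) * (N : ℚ) ^ (2 * p)
    set cq : ℚ := (((N : ℚ) ^ (2 * (p + 1)) - (N : ℚ) ^ (2 * p + 1)) * ((N : ℚ) ^ (2 * (p + 1)) - (N : ℚ) ^ (2 * p)))⁻¹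
    have hr₁ : ((r₁ : ℚ) : ℂ) = -(q₁ + q₂) := by
      simp only [r₁, q₁, q₂]
      push_cast
      rfl
    have hr₂ : ((r₂ : ℚ) : ℂ) = q₁ * q₂ := by
      simp only [r₂, q₁, q₂]
      push_cast
      rfl
    have hcq : ((cq : ℚ) : ℂ) = ((q₀ - q₁) * (q₀ - q₂))⁻¹ := by
      simp only [cq, q₀, q₁, q₂]
      push_cast
      rfl
    have hQ : IsRationalClass (T (T w) + ((r₁ : ℚ) : ℂ) • T w + ((r₂ : ℚ) : ℂ) • w) :=
      IsRationalClass.add (IsRationalClass.add (hTQ _ (hTQ _ hw)) (IsRationalClass.smul (hTQ _ hw) r₁)) (IsRationalClass.smul hw r₂)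
    have heq : e w = ((cq : ℚ) : ℂ) • (T (T w) + ((r₁ : ℚ) : ℂ) • T w + ((r₂ : ℚ) : ℂ) • w) := by
      rw [he, hcq, hr₁, hr₂, neg_smul, ← sub_eq_add_neg]
    rw [heq]
    exact IsRationalClass.smul hQ cq
  · -- (π): only (wt) is used
    intro w
    have h1 : complexBetti.map (fiberι f t) (2 * (p + 1)) (T w) = q₀ • complexBetti.map (fiberι f t) (2 * (p + 1)) w := hwt w
    have h2 : complexBetti.map (fiberι f t) (2 * (p + 1)) (T (T w)) = (q₀ * q₀) • complexBetti.map (fiberι f t) (2 * (p + 1)) w := by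
      rw [show complexBetti.map (fiberι f t) (2 * (p + 1)) (T (T w)) = q₀ • complexBetti.map (fiberι f t) (2 * (p + 1)) (T w)
        from hwt (T w), h1, smul_smul]
    have key : (q₀ * q₀) • complexBetti.map (fiberι f t) (2 * (p + 1)) w - (q₁ + q₂) • q₀ • complexBetti.map (fiberι f t) (2 * (p + 1)) w +
        (q₁ * q₂) • complexBetti.map (fiberι f t) (2 * (p + 1)) w = ((q₀ - q₁) * (q₀ - q₂)) • complexBetti.map (fiberι f t) (2 * (p + 1)) w := by
      module
    rw [he, map_smul, map_add, map_sub, map_smul, map_smul, h2, h1, key, smul_smul, inv_mul_cancel₀ hc, one_smul]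
  · -- (κ): (wt₃) and (top)
    intro w hw0
    obtain ⟨w₀, w₁, w₂, hsum, h₀, h₁, h₂⟩ := hwt₃ w
    rw [hcomp w w₀ w₁ w₂ hsum h₀ h₁ h₂]
    refine htop w₀ h₀ ?_
    have hww₀ : complexBetti.map (fiberι f t) (2 * (p + 1)) w = complexBetti.map (fiberι f t) (2 * (p + 1)) w₀ := by
      rw [hsum, map_add, map_add, map_fiberι_eq_zero_of_weight_lt t ν hN (by omega : 2 * p + 1 < 2 * (p + 1)) hwt h₁,
        map_fiberι_eq_zero_of_weight_lt t ν hN (by omega : 2 * p < 2 * (p + 1)) hwt h₂, add_zero, add_zero]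
    rw [← hww₀, hw0]
  · -- `e`-fixed ⟺ top weight
    intro y
    refine ⟨fun hy ↦ ?_, fun hy ↦ ?_⟩
    · obtain ⟨w₀, w₁, w₂, hsum, h₀, h₁, h₂⟩ := hwt₃ y
      have hyw : y = w₀ := hy.symm.trans (hcomp y w₀ w₁ w₂ hsum h₀ h₁ h₂)
      rw [hyw]
      exact h₀
    · have hT1 : T y = q₀ • y := hy
      have key : (q₀ * q₀) • y - (q₁ + q₂) • q₀ • y + (q₁ * q₂) • y = ((q₀ - q₁) * (q₀ - q₂)) • y := by
        module
      rw [he, hT1, map_smul, hT1, smul_smul, key, smul_smul, inv_mul_cancel₀ hc, one_smul]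

/-- **A CLAUSE OF (β′_f) SUPPLIES THE IDEMPOTENT TOO.** If an algebraic correspondence `T : H^{2p+2}(𝒳) → H^{2p}(𝒳)` inverts the
fibre-class operator `L_t = j_{t*} j_t^*` on fibre restrictions (`j_s^* T L_t = j_s^*` for every `s` — the clause `p ≤ d` of part VIII's
`FibreClassLefschetzOn`), then `e = T ∘ L_t` is an algebraic correspondence (`L_t` is, and compositions are — parts XXII-e and the tree's
`isAlgebraicCorrespondence_fiberGysin_comp_map`) with `j_s^* ∘ e = j_s^*` for EVERY `s` and `e|_{ker j_t^*} = 0`. (Π2) is not claimed: `T`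
has complex coefficients. [cite: Abdulali1994FamiliesAV, Conjecture 5.3 (p. 1130)] [cite: Andre1996Motifs, §2.1 (p. 14) and Remarque 2 (p. 33)] -/
theorem exists_lerayIdempotent_of_fibreClassLefschetz_clause (hf : IsCompactAbelianPencil f d) (t : ComplexPoints S) {p : ℕ}
    (hp : p ≤ d) {T : complexBetti 𝒳 (2 * (p + 1)) →ₗ[ℂ] complexBetti 𝒳 (2 * p)}
    (hT : IsAlgebraicCorrespondence (d + 1) (d + 1) 𝒳 𝒳 T)
    (hTL : ∀ (W : complexBetti 𝒳 (2 * p)) (s : ComplexPoints S),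
      complexBetti.map (fiberι f s) (2 * p) (T (fiberGysin hf t p (complexBetti.map (fiberι f t) (2 * p) W))) =
        complexBetti.map (fiberι f s) (2 * p) W) :
    ∃ e : complexBetti 𝒳 (2 * p) →ₗ[ℂ] complexBetti 𝒳 (2 * p),
      IsAlgebraicCorrespondence (d + 1) (d + 1) 𝒳 𝒳 e ∧
      (∀ (w : complexBetti 𝒳 (2 * p)) (s : ComplexPoints S),
        complexBetti.map (fiberι f s) (2 * p) (e w) = complexBetti.map (fiberι f s) (2 * p) w) ∧
      (∀ w, complexBetti.map (fiberι f t) (2 * p) w = 0 → e w = 0) := by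
  refine ⟨T ∘ₗ (fiberGysin hf t p ∘ₗ (complexBetti.map (fiberι f t) (2 * p)).hom), ?_, fun w s ↦ hTL w s, fun w hw ↦ ?_⟩
  · exact IsAlgebraicCorrespondence.comp hf.isSmoothProjective_total hf.isSmoothProjective_total hf.isSmoothProjective_total
      (isAlgebraicCorrespondence_fiberGysin_comp_map hf t hp) hT (by omega)
  · have hw' : (complexBetti.map (fiberι f t) (2 * p)).hom w = 0 := hw
    simp only [LinearMap.comp_apply, hw', map_zero]

/-- **(β′_f) for the pencil ⟹ an idempotent with (Π1), (π) everywhere, (κ), in every degree `2p ≤ 2d` at every point.**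
[cite: Abdulali1994FamiliesAV, Conjecture 5.3 (p. 1130)] [cite: Andre1996Motifs, Remarque 2 (p. 33)] -/
theorem exists_lerayIdempotent_of_fibreClassLefschetzOn (hf : IsCompactAbelianPencil f d) (h : FibreClassLefschetzOn hf)
    (t : ComplexPoints S) {p : ℕ} (hp : p ≤ d) :
    ∃ e : complexBetti 𝒳 (2 * p) →ₗ[ℂ] complexBetti 𝒳 (2 * p),
      IsAlgebraicCorrespondence (d + 1) (d + 1) 𝒳 𝒳 e ∧
      (∀ (w : complexBetti 𝒳 (2 * p)) (s : ComplexPoints S),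
        complexBetti.map (fiberι f s) (2 * p) (e w) = complexBetti.map (fiberι f s) (2 * p) w) ∧
      (∀ w, complexBetti.map (fiberι f t) (2 * p) w = 0 → e w = 0) := by
  obtain ⟨T, hT, hTL⟩ := h p hp
  exact exists_lerayIdempotent_of_fibreClassLefschetz_clause hf t hp hT fun W s ↦ hTL W t s

end Suppliers

end Summit.HodgeConjecture.HodgeConjecture.Ring2.AbelianAll

end
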